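import Summits.Langlands.Langlands.Theorems.IrreducibilityBySelfDualityPairLBoundaryJS
import Summits.Langlands.Langlands.Theorems.IrreducibilityBySelfDualityPairLBoundaryJSSsv
import Summits.Langlands.Langlands.Theorems.IrreducibilityBySelfDualityPairLBoundaryJSStandardEntire
import Summits.Langlands.Langlands.Theorems.IrreducibilityBySelfDualityPairLBoundaryJSIsOrthoOfLocalTranslate
import Summits.Langlands.Langlands.Theorems.IrreducibilityBySelfDualityPairLBoundaryJSEqConjOfLocalTranslate
import Summits.Langlands.Langlands.Theorems.IrreducibilityBySelfDualityPairLBoundaryJSLocalPairTranslate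
import Summits.Langlands.Langlands.Theorems.IrreducibilityBySelfDualityPairLBoundaryJSOfHumphriesJo
import Summits.Langlands.Langlands.Theorems.IrreducibilityBySelfDualityPairLBoundaryJSCornerBochnerIwasawa
import Summits.Langlands.Langlands.Theorems.IrreducibilityBySelfDualityPairLBoundaryJSCornerPairTranslate
import Summits.Langlands.Langlands.Theorems.IrreducibilityBySelfDualityPairLBoundaryJSCornerPairEuler
import Summits.Langlands.Langlands.Theorems.IrreducibilityBySelfDualityPairLBoundaryJSCornerAbsMajorant
import Summits.Langlands.Langlands.Theorems.IrreducibilityBySelfDualityPairLBoundaryJSCornerAbsIdeleMoment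
import Literature.NumberTheory.Automorphic.PairLFunctionMeromorphicContinuationRankNeTwistProofs
import Literature.NumberTheory.Automorphic.ArchRankinSelbergTestVector
import Literature.NumberTheory.Automorphic.JPSSGlobalIntegralQuotientUnfolding
import Literature.NumberTheory.Automorphic.JPSSCornerWhittakerUnfolding
import Literature.NumberTheory.Automorphic.WhittakerPeriodExchange
import Literature.NumberTheory.Automorphic.TorusIwasawaTransport
import Literature.NumberTheory.Automorphic.CornerTorusIwasawaData
import Literature.NumberTheory.Automorphic.WhittakerCoeffHonestCuspForm
import Literature.NumberTheory.Automorphic.WhittakerCoeffTranslateUnramified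
import Literature.NumberTheory.Automorphic.WhittakerDecayCuspForm
import Literature.NumberTheory.Automorphic.WhittakerSupportFinite
import Literature.NumberTheory.Automorphic.RankinSelbergUnramifiedTorus
import Literature.NumberTheory.Automorphic.RankinSelbergTorusPairEuler
import Literature.NumberTheory.Automorphic.RankinSelbergTowerFiniteness

/-!
# Absolute convergence of the unfolded corner integral from the torus majorant

Summit `Langlands`, sub-problem `Langlands`, helper file under `Theorems/` supporting the crux
`PairLBoundaryJS` (stmt-Langlands-13622), line `Sketch`, registered stub
`stub_corner_abs_convergence_one_of_torus_majorant` (W-Ac, part 4 of 4). The absolute convergence of the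
unfolded `GL_{m+1} × GL_m` corner integral for `Re s ≫ 0` (Cogdell (2004), §2.3 "converges for `Re s ≫ 0`
by the gauge estimates"; Jacquet–Piatetski-Shapiro–Shalika (1983), §2) in its ONE-factor form

  `∫_{(𝔸_Kˣ)ᵐ × K_m} |W_φ(diag(diag(a) k, 1))| |det a|^σ δ_B(a)⁻¹ d(νA × νK) < ∞`  (`σ ≥ σ₀`),

`W_φ = whittakerDepth 0 φ`, DERIVED from the finiteness of the torus integral of the majorant
(hypothesis `H3`, the registered neighbour `stub_corner_torus_majorant`) and the landed pointwise corner
majorant `CornerAbsMajorant.corner_majorant` (support `|a_{l,v}|_v ≤ R_v`, archimedean decay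
`‖W_φ‖ ≤ C ∏_{l,w} min(1, ‖a_{l,w}‖^{-M})` for every `M`):

* `lintegral_corner_lt_top_of_majorant` — the parametrised implication: `σ₀ = m + 1`; for `σ ≥ σ₀` take
  `E = ⌈σ⌉₊ + m`, `M = [K:ℚ] E + dim_ℝ K_∞ + 1`, bound the integrand pointwise by `C` times the majorant
  in the torus coordinate, `lintegral_mono`, `lintegral_prod_le` (no measurability needed) and
  `νK(K_m) < ∞` (`K_m` is compact, `isCompact_maximalCompactAdelic`);
* `stub_corner_abs_convergence_one_of_torus_majorant` — the registered `∀`-closed implication.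

## References

* J. W. Cogdell, *Analytic theory of L-functions for GL_n*, in *An Introduction to the Langlands
  Program* (2004), §2.3 [CogdellAnalyticTheory2004].
* H. Jacquet, I. I. Piatetski-Shapiro, J. Shalika, *Rankin–Selberg convolutions*, Amer. J. Math. 105
  (1983), §2 [JPSS1983].
-/

noncomputable section

-- `Summit.Langlands.Langlands.…` (summit = sub-problem name, D-0017 layout) trips `dupNamespace`
set_option linter.dupNamespace false

open scoped MatrixGroups Topology Pointwise ENNReal NNReal ComplexConjugate InnerProductSpace ContDiff
-- the place subtypes indexing `mixedSpace K` are `Fintype` classically (`NormedCommRing (mixedSpace K)`)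
open scoped Classical Matrix.Norms.Operator
open NumberField IsDedekindDomain MeasureTheory Measure Matrix Set Filter WithZero
open NumberField.mixedEmbedding
open Literature.NumberTheory.Automorphic AdelicGroupData
open Literature.NumberTheory.GaloisRepresentations (ideleGroup HeckeCharacter)
open Literature.MeasureTheory.Group
open Literature.RingTheory.SymmetricFunctions.SymmPoly
open ValuativeRel

-- the automorphic quotient carries the tree's Borel σ-algebra, not Mathlib's quotient σ-algebra
attribute [-instance] Quotient.instMeasurableSpace QuotientGroup.measurableSpace

-- the house local instances, exactly as in `RankinSelbergUnfoldingIdentity`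
attribute [local instance] adelicBorel borelSpace_adelic locallyCompactSpace_adelic secondCountableTopology_gl_adelic
  glAdeleBorel borelSpace_glAdele borelSpace_ideleGroup secondCountableTopology_ideleGroup

-- Mathlib idiom: the commutator Lie ring on matrices, to mention `(archGroupGL n K).lie`
attribute [local instance 100] LieRing.ofAssociativeRing


namespace Summit.Langlands.Langlands.Theorems.CornerAbsConvergence

section Main

variable {m : ℕ} {K : Type} [Field K] [NumberField K]

/-- **Pointwise domination of the corner integrand by the torus majorant.** If `W` is supported in
`{|a_{l,v}|_v ≤ R_v ∀ l, v}` at the corner torus points and `‖W(diag(diag(a) k, 1))‖ ≤ C · D(a)` with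
`C ≥ 0`, then `‖W(diag(diag(a) k, 1))‖ₑ · w(a) ≤ C · (𝟙{|a_{l,v}|_v ≤ R_v} · D(a) · w(a))` in `ℝ≥0∞` for every
weight `w ≥ 0` (case split on `W = 0`). [folklore] -/
theorem enorm_mul_ofReal_le_of_majorant {W : GL (Fin (m + 1)) (AdeleRing (𝓞 K) K) → ℂ}
    {R : HeightOneSpectrum (𝓞 K) → WithZero (Multiplicative ℤ)}
    (hsupp : ∀ (a : Fin m → ideleGroup K) (k : ↥(maximalCompactAdelic m K)),
      W (glCorner (AdeleRing (𝓞 K) K) (Nat.le_succ m) (torusPoint m K (a, k))) ≠ 0 →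
      ∀ (l : Fin m) (v : HeightOneSpectrum (𝓞 K)), Valued.v (((a l : ideleGroup K) : AdeleRing (𝓞 K) K).2 v) ≤ R v)
    {C : ℝ} (hC0 : 0 ≤ C) {D : (Fin m → ideleGroup K) → ℝ}
    (hC : ∀ (a : Fin m → ideleGroup K) (k : ↥(maximalCompactAdelic m K)),
      ‖W (glCorner (AdeleRing (𝓞 K) K) (Nat.le_succ m) (torusPoint m K (a, k)))‖ ≤ C * D a)
    (w : (Fin m → ideleGroup K) → ℝ) (a : Fin m → ideleGroup K) (k : ↥(maximalCompactAdelic m K)) :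
    ‖W (glCorner (AdeleRing (𝓞 K) K) (Nat.le_succ m) (torusPoint m K (a, k)))‖ₑ * ENNReal.ofReal (w a) ≤
      ENNReal.ofReal C *
        ((if ∀ (l : Fin m) (v : HeightOneSpectrum (𝓞 K)),
            Valued.v (((a l : ideleGroup K) : AdeleRing (𝓞 K) K).2 v) ≤ R v then 1 else 0) *
          ENNReal.ofReal (D a) * ENNReal.ofReal (w a)) := by
  by_cases hW : W (glCorner (AdeleRing (𝓞 K) K) (Nat.le_succ m) (torusPoint m K (a, k))) = 0
  · rw [hW, enorm_zero, zero_mul]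
    exact zero_le
  · rw [if_pos (hsupp a k hW), one_mul, ← ofReal_norm, ← mul_assoc, ← ENNReal.ofReal_mul hC0]
    exact mul_le_mul' (ENNReal.ofReal_le_ofReal (hC a k)) le_rfl

-- (the Borel property of the adelic σ-algebra is not needed for the upper bound)
variable [MeasurableSpace (AdeleRing (𝓞 K) K)]

/-- **Absolute convergence of the unfolded corner integral (one-factor form) from the torus majorant**
(Cogdell (2004), §2.3; JPSS (1983), §2). Let `φ` be an `A_G`-invariant honest cusp form on `GL_{m+1}(𝔸_K)`
(`0 < m`), `νA`, `νK` Haar measures on `(𝔸_Kˣ)ᵐ` and `K_m`, and assume (`H3`) that for every finite `S`,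
bounds `R_v ≥ 1` equal to `1` off `S`, `σ ≥ m + 1`, `E ≥ σ + m`, `M ≥ [K:ℚ] E + dim_ℝ K_∞ + 1` the torus
integral `∫ 𝟙{|a_{l,v}|_v ≤ R_v} ∏_{l,w} min(1, ‖a_{l,w}‖^{-M}) |det a|^σ δ_B(a)⁻¹ dνA` is finite. Then for
`σ ≥ m + 1`, `∫ |W_φ(diag(diag(a) k, 1))| |det a|^σ δ_B(a)⁻¹ d(νA × νK) < ∞`: by the corner majorant
`CornerAbsMajorant.corner_majorant` (with `E = ⌈σ⌉₊ + m`, `M = [K:ℚ] E + dim_ℝ K_∞ + 1`) the integrand is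
pointwise `≤ C` times the majorant in the torus coordinate, and `νK(K_m) < ∞`.
[cite: CogdellAnalyticTheory2004, §2.3] -/
theorem lintegral_corner_lt_top_of_majorant (hm : 0 < m)
    (νA : Measure (Fin m → ideleGroup K)) [IsHaarMeasure νA]
    (νK : Measure ↥(maximalCompactAdelic m K)) [IsHaarMeasure νK]
    {φ : GL (Fin (m + 1)) (AdeleRing (𝓞 K) K) → ℂ}
    (hφ : IsCuspFormGL (m + 1) K (isCompact_glFiniteIntegralLevel_holds (m + 1) K) φ)
    (hA : ∀ z ∈ (AdelicGroupData.gl (m + 1) K).center', ∀ g : (AdelicGroupData.gl (m + 1) K).Adelic, φ (z * g) = φ g)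
    (H3 : ∀ (S : Finset (HeightOneSpectrum (𝓞 K))) {R : HeightOneSpectrum (𝓞 K) → WithZero (Multiplicative ℤ)},
      (∀ v, 1 ≤ R v) → (∀ v ∉ S, R v = 1) →
      ∀ {σ : ℝ}, (m : ℝ) + 1 ≤ σ → ∀ {E M : ℕ}, σ + m ≤ E →
      Module.finrank ℚ K * E + Module.finrank ℝ (mixedSpace K) + 1 ≤ M →
      ∫⁻ a, (if ∀ (l : Fin m) (v : HeightOneSpectrum (𝓞 K)),
              Valued.v (((a l : ideleGroup K) : AdeleRing (𝓞 K) K).2 v) ≤ R v then 1 else 0) *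
          ENNReal.ofReal (∏ l : Fin m, ∏ w : InfinitePlace K,
            ((max 1 ‖((a l : ideleGroup K) : AdeleRing (𝓞 K) K).1 w‖) ^ M)⁻¹) *
          ENNReal.ofReal (torusWeight m K σ a) ∂νA < ⊤) :
    ∃ σ₀ : ℝ, ∀ σ : ℝ, σ₀ ≤ σ →
      ∫⁻ p, ‖whittakerDepth 0 φ (glCorner (AdeleRing (𝓞 K) K) (Nat.le_succ m) (torusPoint m K p))‖ₑ *
          ENNReal.ofReal (torusWeight m K σ p.1) ∂(νA.prod νK) < ⊤ := by
  -- `K_m` is compact, so the Haar measure `νK` is finite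
  haveI : CompactSpace ↥(maximalCompactAdelic m K) :=
    isCompact_iff_compactSpace.1 (isCompact_maximalCompactAdelic m K)
  have hK : νK Set.univ < ⊤ := measure_lt_top νK _
  -- the corner majorant of `W_φ`
  obtain ⟨S, R, hR, hRS, hsupp, hdec⟩ := CornerAbsMajorant.corner_majorant hm hφ hA
  refine ⟨(m : ℝ) + 1, fun σ hσ => ?_⟩
  -- exponents `E ≥ σ + m`, `M = [K:ℚ] E + dim K_∞ + 1`
  have hE : σ + m ≤ ((⌈σ⌉₊ + m : ℕ) : ℝ) := by
    rw [Nat.cast_add]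
    exact add_le_add (Nat.le_ceil σ) le_rfl
  obtain ⟨C, hC0, hC⟩ := hdec (Module.finrank ℚ K * (⌈σ⌉₊ + m) + Module.finrank ℝ (mixedSpace K) + 1)
  -- the torus majorant and its finiteness (hypothesis `H3`)
  set G : (Fin m → ideleGroup K) → ℝ≥0∞ := fun a =>
    (if ∀ (l : Fin m) (v : HeightOneSpectrum (𝓞 K)),
        Valued.v (((a l : ideleGroup K) : AdeleRing (𝓞 K) K).2 v) ≤ R v then 1 else 0) *
      ENNReal.ofReal (∏ l : Fin m, ∏ w : InfinitePlace K,
        ((max 1 ‖((a l : ideleGroup K) : AdeleRing (𝓞 K) K).1 w‖) ^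
          (Module.finrank ℚ K * (⌈σ⌉₊ + m) + Module.finrank ℝ (mixedSpace K) + 1))⁻¹) *
      ENNReal.ofReal (torusWeight m K σ a) with hG_def
  have hfin : ∫⁻ a, G a ∂νA < ⊤ := H3 S hR hRS hσ hE le_rfl
  -- pointwise domination
  have hpt : ∀ p : (Fin m → ideleGroup K) × ↥(maximalCompactAdelic m K),
      ‖whittakerDepth 0 φ (glCorner (AdeleRing (𝓞 K) K) (Nat.le_succ m) (torusPoint m K p))‖ₑ *
          ENNReal.ofReal (torusWeight m K σ p.1) ≤ ENNReal.ofReal C * G p.1 := fun p =>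
    enorm_mul_ofReal_le_of_majorant hsupp hC0 hC (torusWeight m K σ) p.1 p.2
  have hCK : ENNReal.ofReal C * νK Set.univ < ⊤ := ENNReal.mul_lt_top ENNReal.ofReal_lt_top hK
  calc ∫⁻ p, ‖whittakerDepth 0 φ (glCorner (AdeleRing (𝓞 K) K) (Nat.le_succ m) (torusPoint m K p))‖ₑ *
          ENNReal.ofReal (torusWeight m K σ p.1) ∂(νA.prod νK)
      ≤ ∫⁻ p, ENNReal.ofReal C * G p.1 ∂(νA.prod νK) := lintegral_mono hpt
    _ ≤ ∫⁻ a, ∫⁻ _k, ENNReal.ofReal C * G a ∂νK ∂νA :=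
        lintegral_prod_le (fun p : (Fin m → ideleGroup K) × ↥(maximalCompactAdelic m K) => ENNReal.ofReal C * G p.1)
    _ = ∫⁻ a, ENNReal.ofReal C * νK Set.univ * G a ∂νA := by
        refine lintegral_congr fun a => ?_
        rw [lintegral_const, mul_right_comm]
    _ = ENNReal.ofReal C * νK Set.univ * ∫⁻ a, G a ∂νA := lintegral_const_mul' _ _ hCK.ne
    _ < ⊤ := ENNReal.mul_lt_top hCK hfin

end Main

/-! ### The registered stub -/

/-- **STUB (W-Ac 4/4) — the one-factor absolute convergence FROM the torus majorant**: the implication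
`stub_corner_torus_majorant → (W-Ac-one)`: if the torus integral of the majorant
`𝟙{|a_{l,v}|_v ≤ R_v} ∏_{l,w} min(1, ‖a_{l,w}‖^{-M}) |det a|^σ δ_B(a)⁻¹` is finite for `σ ≥ m + 1`, `E ≥ σ + m`,
`M ≥ [K:ℚ] E + dim_ℝ K_∞ + 1`, then for every `A_G`-invariant honest cusp form `φ` on `GL_{m+1}(𝔸_K)` (`0 < m`)
there is `σ₀` with `∫ |W_φ(diag(diag(a) k, 1))| |det a|^σ δ_B(a)⁻¹ d(νA × νK) < ∞` for all `σ ≥ σ₀` — by the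
corner majorant of `W_φ` (`CornerAbsMajorant.corner_majorant`), monotonicity of the lintegral and
`νK(K_m) < ∞`; the `∀`-closed form of `lintegral_corner_lt_top_of_majorant` (Cogdell (2004), §2.3).
[cite: CogdellAnalyticTheory2004, §2.3] -/
theorem stub_corner_abs_convergence_one_of_torus_majorant :
    (∀ {m : ℕ} {K : Type} [Field K] [NumberField K]
      [MeasurableSpace (AdeleRing (𝓞 K) K)] [BorelSpace (AdeleRing (𝓞 K) K)]
      (νA : Measure (Fin m → ideleGroup K)) [IsHaarMeasure νA]
      (S : Finset (HeightOneSpectrum (𝓞 K))) {R : HeightOneSpectrum (𝓞 K) → WithZero (Multiplicative ℤ)},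
      (∀ v, 1 ≤ R v) → (∀ v ∉ S, R v = 1) →
      ∀ {σ : ℝ}, (m : ℝ) + 1 ≤ σ → ∀ {E M : ℕ}, σ + m ≤ E →
      Module.finrank ℚ K * E + Module.finrank ℝ (mixedSpace K) + 1 ≤ M →
      ∫⁻ a, (if ∀ (l : Fin m) (v : HeightOneSpectrum (𝓞 K)),
              Valued.v (((a l : ideleGroup K) : AdeleRing (𝓞 K) K).2 v) ≤ R v then 1 else 0) *
          ENNReal.ofReal (∏ l : Fin m, ∏ w : InfinitePlace K,
            ((max 1 ‖((a l : ideleGroup K) : AdeleRing (𝓞 K) K).1 w‖) ^ M)⁻¹) *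
          ENNReal.ofReal (torusWeight m K σ a) ∂νA < ⊤) →
    ∀ {m : ℕ} {K : Type} [Field K] [NumberField K]
      [MeasurableSpace (AdeleRing (𝓞 K) K)] [BorelSpace (AdeleRing (𝓞 K) K)] (_hm : 0 < m)
      (νA : Measure (Fin m → ideleGroup K)) [IsHaarMeasure νA]
      (νK : Measure ↥(maximalCompactAdelic m K)) [IsHaarMeasure νK]
      {φ : GL (Fin (m + 1)) (AdeleRing (𝓞 K) K) → ℂ},
      IsCuspFormGL (m + 1) K (isCompact_glFiniteIntegralLevel_holds (m + 1) K) φ →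
      (∀ z ∈ (AdelicGroupData.gl (m + 1) K).center', ∀ g : (AdelicGroupData.gl (m + 1) K).Adelic, φ (z * g) = φ g) →
      ∃ σ₀ : ℝ, ∀ σ : ℝ, σ₀ ≤ σ →
        ∫⁻ p, ‖whittakerDepth 0 φ (glCorner (AdeleRing (𝓞 K) K) (Nat.le_succ m) (torusPoint m K p))‖ₑ *
            ENNReal.ofReal (torusWeight m K σ p.1) ∂(νA.prod νK) < ⊤ := by
  intro H3 m K _ _ _ _ hm νA _ νK _ φ hφ hA
  exact lintegral_corner_lt_top_of_majorant hm νA νK hφ hA (fun S R hR hRS σ hσ E M hE hM =>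
    H3 νA S hR hRS hσ hE hM)

end Summit.Langlands.Langlands.Theorems.CornerAbsConvergence

end
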